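import Summits.Ventures.GridStability.Models.InverterNetworkLinearisation

/-!
# GridStability/Models/InverterNetworkDamping — HETEROGENEOUS damping / filter constants: every non-synchronous mode of a lossless network with an acute equilibrium is damped (any `n`, no certificate at all)

Cell `gridfusion` (LADDER-GRIDFUSION, APEX LINE, G3-ss; seat gridfusion-model-3 (g5)). Refines the CEILING line
of `Models/InverterNetworkLinearisation.lean` (p497389: «heterogeneous filter constants break the decoupling —
then the row needs certnum's box tool or an LMI»): the decoupling into quadratics over ONE pencil is lost, but
the QUALITATIVE small-signal answer is still free. For the classical network-reduced model / frozen-voltage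
droop microgrid with ARBITRARY positive inertias `M_i` and dampings `D_i` (droop: arbitrary positive filter
constants `τ_Pi` and gains `λ^p_i`), lossless reciprocal network, at an angle configuration `δ`:

* `jacMatrix_eig_iff` — `[x; y]` is an eigenvector of `J(δ)` for `z` iff `y = z x` and, for every unit,
  `(L(δ) x)_i + z D_i x_i + z² M_i x_i = 0` (the linearised swing equations `M ẍ + D ẋ + L x = 0`);
* `eig_rayleigh` — hence `x*L(δ)x + z·(Σ D_i|x_i|²) + z²·(Σ M_i|x_i|²) = 0`: every mode is a root of a
  QUADRATIC with the positive coefficients `Σ M_i|x_i|²`, `Σ D_i|x_i|²` and the constant term `x*L(δ)x`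
  (the Rayleigh-quotient form of the eigen-problem; [folklore], cf. [cite: DorflerBullo2012, §II]
  «`(θ*, 0)` is a hyperbolic type-`k` equilibrium of the classical model iff `θ*` is a type-`k` equilibrium
  of the gradient system», after Chiang–Wu–Varaiya 1988);
* `PeJac_quadForm_nonneg` / `PeJac_posSemidef_of_acute` — if every synchronising coefficient is nonnegative
  (`C_ij cos(δ_i − δ_j) ≥ 0`, `i ≠ j`: ACUTE equilibrium line angles with `B_ij ≥ 0`) then `L(δ)` is a
  weighted graph Laplacian, `uᵀL(δ)u = ½ΣΣ w_ij (u_i − u_j)² ≥ 0`, i.e. `L(δ) ⪰ 0` — a SIGN CHECK, no PSD computation;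
* **`eig_re_neg_of_posSemidef`** — `M_i, D_i > 0`, `L(δ) ⪰ 0` ⇒ every complex eigenpair of `J(δ)` is
  synchronous-type (`L(δ) x = 0`; then `z = 0` or `z = −(Σ D_i|x_i|²)/(Σ M_i|x_i|²) < 0`, `eig_sync_general`)
  or has `Re z < 0`; `DroopMicrogrid.eig_re_neg_of_acute` — the same read on ANY lossless droop microgrid with
  positive (not necessarily common) filter constants and gains at frozen voltages.

So (memo §3, corrected lever/ceiling): with heterogeneous filters the Hurwitz property off the synchronous mode
costs NOTHING (sign checks); what the box tool / LMI / the uniform lane (`eig_re_lt_neg_of_commonFilter`) buys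
is a certified RATE. THREE COLUMNS: CERTIFIED = matrix statements about `J(δ)`; MODELLED: MV-2L / MV-6N +
lossless reciprocal network [cite: SauerPai1998, §6.10] [cite: KunduEtAl2019, eqs. (4a)–(4b), (5a)]
[cite: SchifferEtAl2014, Remark 3.3]; nothing about the nonlinear flow; no sentence says a grid or a microgrid
is stable.
-/

noncomputable section

open Real Matrix Finset
open scoped ComplexOrder ComplexConjugate

namespace Summit.Ventures.GridStability.Models

namespace ClassicalSwing

variable {n : ℕ} (p : ClassicalSwing n)

/-! ## §1 The eigen-equation of `J(δ)` for arbitrary damping -/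

/-- `J(δ)` with real data, read over `ℂ`, applied to `[x; y]`:
`[y; −M⁻¹L(δ)x − diag(D/M) y]`. [folklore] -/
theorem jacMatrix_map_mulVec (δ : Fin n → ℝ) (w : Fin n ⊕ Fin n → ℂ) :
    (p.jacMatrix δ).map ((↑) : ℝ → ℂ) *ᵥ w
      = Sum.elim (w ∘ Sum.inr) (fun i => -(((p.Ablock δ).map ((↑) : ℝ → ℂ) *ᵥ (w ∘ Sum.inl)) i)
          - ((p.D i / p.M i : ℝ) : ℂ) * (w ∘ Sum.inr) i) := by
  rw [jacMatrix, Matrix.fromBlocks_map, Matrix.fromBlocks_mulVec]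
  have h0 : (0 : Matrix (Fin n) (Fin n) ℝ).map ((↑) : ℝ → ℂ) = 0 := by ext; simp
  have h1 : (1 : Matrix (Fin n) (Fin n) ℝ).map ((↑) : ℝ → ℂ) = 1 := by
    ext i j; simp [Matrix.one_apply, apply_ite ((↑) : ℝ → ℂ)]
  have hA : (-p.Ablock δ).map ((↑) : ℝ → ℂ) = -((p.Ablock δ).map ((↑) : ℝ → ℂ)) := by ext; simp
  have hD : (-Matrix.diagonal fun i => p.D i / p.M i).map ((↑) : ℝ → ℂ)
      = -Matrix.diagonal fun i => ((p.D i / p.M i : ℝ) : ℂ) := by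
    ext i j
    simp only [Matrix.map_apply, Matrix.neg_apply, Matrix.diagonal_apply]
    split_ifs <;> simp
  rw [h0, h1, hA, hD]
  congr 1
  · simp
  · funext i
    simp [Matrix.neg_mulVec, Matrix.mulVec_diagonal, sub_eq_add_neg]

/-- **Eigen-equation of `J(δ)` (any damping).** `J(δ)[x; y] = z[x; y]` iff `y = z x` and for every unit
`(L(δ) x)_i + z D_i x_i + z² M_i x_i = 0` — the linearised swing equations. [folklore] -/
theorem jacMatrix_eig_iff (hM : ∀ i, p.M i ≠ 0) (δ : Fin n → ℝ) (z : ℂ) (w : Fin n ⊕ Fin n → ℂ) :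
    (p.jacMatrix δ).map ((↑) : ℝ → ℂ) *ᵥ w = z • w ↔
      (w ∘ Sum.inr = z • (w ∘ Sum.inl) ∧
        ∀ i, ((p.PeJac δ).map ((↑) : ℝ → ℂ) *ᵥ (w ∘ Sum.inl)) i + z * (p.D i : ℂ) * (w ∘ Sum.inl) i
          + z ^ 2 * (p.M i : ℂ) * (w ∘ Sum.inl) i = 0) := by
  rw [jacMatrix_map_mulVec]
  have hMi : ∀ i, ((p.M i : ℝ) : ℂ) ≠ 0 := fun i => by exact_mod_cast hM i
  constructor
  · intro h
    have h1 : w ∘ Sum.inr = z • (w ∘ Sum.inl) := by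
      funext i; simpa using congr_fun h (Sum.inl i)
    refine ⟨h1, fun i => ?_⟩
    have h2 := congr_fun h (Sum.inr i)
    have h1i : w (Sum.inr i) = z * w (Sum.inl i) := by simpa using congr_fun h1 i
    simp only [Sum.elim_inr, Pi.smul_apply, smul_eq_mul, Function.comp_apply, h1i,
      Ablock_map_mulVec] at h2
    simp only [Function.comp_apply]
    have key1 : ((p.M i : ℝ) : ℂ) * ((((p.M i)⁻¹ : ℝ)) : ℂ) = 1 := by
      rw [← Complex.ofReal_mul, mul_inv_cancel₀ (hM i), Complex.ofReal_one]
    have key2 : ((p.M i : ℝ) : ℂ) * (((p.D i / p.M i : ℝ)) : ℂ) = (p.D i : ℂ) := by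
      rw [← Complex.ofReal_mul, mul_div_cancel₀ _ (hM i)]
    linear_combination (-((p.M i : ℝ) : ℂ)) * h2
      + (-(((p.PeJac δ).map ((↑) : ℝ → ℂ) *ᵥ (w ∘ Sum.inl)) i)) * key1
      + (-(z * w (Sum.inl i))) * key2
  · rintro ⟨h1, h2⟩
    funext j
    rcases j with i | i
    · have h1i : w (Sum.inr i) = z * w (Sum.inl i) := by simpa using congr_fun h1 i
      simpa using h1i
    · have h1i : w (Sum.inr i) = z * w (Sum.inl i) := by simpa using congr_fun h1 i
      have h2i := h2 i
      simp only [Function.comp_apply] at h2i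
      simp only [Sum.elim_inr, Pi.smul_apply, smul_eq_mul, Function.comp_apply, h1i, Ablock_map_mulVec]
      have key3 : ((((p.M i)⁻¹ : ℝ)) : ℂ) * (p.D i : ℂ) = (((p.D i / p.M i : ℝ)) : ℂ) := by
        rw [← Complex.ofReal_mul]; congr 1; field_simp
      have key4 : ((((p.M i)⁻¹ : ℝ)) : ℂ) * ((p.M i : ℝ) : ℂ) = 1 := by
        rw [← Complex.ofReal_mul, inv_mul_cancel₀ (hM i), Complex.ofReal_one]
      linear_combination (-((((p.M i)⁻¹ : ℝ)) : ℂ)) * h2i + (z * w (Sum.inl i)) * key3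
        + (z ^ 2 * w (Sum.inl i)) * key4

/-- An eigenvector of `J(δ)` has a nonzero ANGLE part. [folklore] -/
theorem jacMatrix_eig_fst_ne_zero (hM : ∀ i, p.M i ≠ 0) (δ : Fin n → ℝ) {z : ℂ} {w : Fin n ⊕ Fin n → ℂ}
    (hJ : (p.jacMatrix δ).map ((↑) : ℝ → ℂ) *ᵥ w = z • w) (hw : w ≠ 0) : w ∘ Sum.inl ≠ 0 := by
  intro hx
  apply hw
  have h1 := ((p.jacMatrix_eig_iff hM δ z w).1 hJ).1
  rw [hx, smul_zero] at h1
  funext j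
  rcases j with i | i
  · exact congr_fun hx i
  · exact congr_fun h1 i

/-- **Rayleigh form of the eigen-problem**: for an eigenpair `(z, [x; y])`,
`x*L(δ)x + z·Σ D_i|x_i|² + z²·Σ M_i|x_i|² = 0`. [folklore] (cf. [cite: DorflerBullo2012, §II]) -/
theorem eig_rayleigh (hM : ∀ i, p.M i ≠ 0) (δ : Fin n → ℝ) {z : ℂ} {w : Fin n ⊕ Fin n → ℂ}
    (hJ : (p.jacMatrix δ).map ((↑) : ℝ → ℂ) *ᵥ w = z • w) :
    star (w ∘ Sum.inl) ⬝ᵥ ((p.PeJac δ).map ((↑) : ℝ → ℂ) *ᵥ (w ∘ Sum.inl))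
      + z * ((∑ i, p.D i * Complex.normSq ((w ∘ Sum.inl) i) : ℝ) : ℂ)
      + z ^ 2 * ((∑ i, p.M i * Complex.normSq ((w ∘ Sum.inl) i) : ℝ) : ℂ) = 0 := by
  have h2 := ((p.jacMatrix_eig_iff hM δ z w).1 hJ).2
  have hsum : ∑ i, star ((w ∘ Sum.inl) i) *
      (((p.PeJac δ).map ((↑) : ℝ → ℂ) *ᵥ (w ∘ Sum.inl)) i + z * (p.D i : ℂ) * (w ∘ Sum.inl) i
        + z ^ 2 * (p.M i : ℂ) * (w ∘ Sum.inl) i) = 0 :=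
    Finset.sum_eq_zero fun i _ => by rw [h2 i, mul_zero]
  simp only [dotProduct, Pi.star_apply]
  push_cast
  rw [Finset.mul_sum, Finset.mul_sum, ← Finset.sum_add_distrib, ← Finset.sum_add_distrib]
  rw [← hsum]
  refine Finset.sum_congr rfl fun i _ => ?_
  rw [Complex.normSq_eq_conj_mul_self, Complex.star_def]
  ring

/-! ## §2 Acute equilibria: `L(δ)` is a weighted Laplacian, hence `⪰ 0` by a sign check -/

/-- **The Laplacian quadratic form**: for a lossless reciprocal network,
`uᵀ L(δ) u = ½ Σ_i Σ_{j ≠ i} a_ij(δ) (u_i − u_j)²` (`a_ij = C_ij cos(δ_i − δ_j)`). [folklore] -/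
theorem PeJac_quadForm (hG : p.IsLossless) (hB : ∀ i j, p.B i j = p.B j i) (δ u : Fin n → ℝ) :
    u ⬝ᵥ (p.PeJac δ *ᵥ u) = (1 / 2) * ∑ i, ∑ j ∈ univ.erase i, p.syncCoef δ i j * (u i - u j) ^ 2 := by
  have h1 : u ⬝ᵥ (p.PeJac δ *ᵥ u) = ∑ i, ∑ j ∈ univ.erase i, p.syncCoef δ i j * (u i * (u i - u j)) := by
    simp only [dotProduct, p.PeJac_mulVec, Finset.mul_sum]
    refine Finset.sum_congr rfl fun i _ => Finset.sum_congr rfl fun j _ => by ring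
  -- the same sum with `i` and `j` exchanged
  have h2 : ∑ i, ∑ j ∈ univ.erase i, p.syncCoef δ i j * (u i * (u i - u j))
      = ∑ i, ∑ j ∈ univ.erase i, p.syncCoef δ i j * (u j * (u j - u i)) := by
    rw [show (∑ i, ∑ j ∈ univ.erase i, p.syncCoef δ i j * (u j * (u j - u i)))
        = ∑ i, ∑ j ∈ univ.erase i, p.syncCoef δ j i * (u i * (u i - u j)) by
      rw [show (∑ i, ∑ j ∈ univ.erase i, p.syncCoef δ j i * (u i * (u i - u j)))
          = ∑ j, ∑ i ∈ univ.erase j, p.syncCoef δ j i * (u i * (u i - u j)) by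
        rw [Finset.sum_comm' (t' := univ) (s' := fun i => univ.erase i)]
        intro i j
        simp only [Finset.mem_univ, Finset.mem_erase, ne_eq, and_true, true_and]
        exact ⟨fun h => fun h' => h h'.symm, fun h => fun h' => h h'.symm⟩]]
    refine Finset.sum_congr rfl fun i _ => Finset.sum_congr rfl fun j hj => ?_
    rw [p.syncCoef_symm hG hB δ (Finset.ne_of_mem_erase hj).symm]
  rw [h1]
  have h3 : ∑ i, ∑ j ∈ univ.erase i, p.syncCoef δ i j * (u i - u j) ^ 2
      = ∑ i, ∑ j ∈ univ.erase i, p.syncCoef δ i j * (u i * (u i - u j))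
        + ∑ i, ∑ j ∈ univ.erase i, p.syncCoef δ i j * (u j * (u j - u i)) := by
    rw [← Finset.sum_add_distrib]
    refine Finset.sum_congr rfl fun i _ => ?_
    rw [← Finset.sum_add_distrib]
    exact Finset.sum_congr rfl fun j _ => by ring
  rw [h3, ← h2]
  ring

/-- **Acute equilibrium ⇒ nonnegative Laplacian form**: if every synchronising coefficient is nonnegative
(`C_ij cos(δ_i − δ_j) ≥ 0` for `i ≠ j`) then `uᵀL(δ)u ≥ 0`. [folklore] -/
theorem PeJac_quadForm_nonneg (hG : p.IsLossless) (hB : ∀ i j, p.B i j = p.B j i) (δ : Fin n → ℝ)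
    (hw : ∀ i j, i ≠ j → 0 ≤ p.syncCoef δ i j) (u : Fin n → ℝ) : 0 ≤ u ⬝ᵥ (p.PeJac δ *ᵥ u) := by
  rw [p.PeJac_quadForm hG hB]
  refine mul_nonneg (by norm_num) (Finset.sum_nonneg fun i _ => Finset.sum_nonneg fun j hj => ?_)
  exact mul_nonneg (hw i j (Finset.ne_of_mem_erase hj).symm) (sq_nonneg _)

/-- **Acute equilibrium ⇒ `L(δ) ⪰ 0`** (a SIGN CHECK on the synchronising coefficients, no PSD computation).
[folklore] -/
theorem PeJac_posSemidef_of_acute (hG : p.IsLossless) (hB : ∀ i j, p.B i j = p.B j i)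
    (δ : Fin n → ℝ) (hw : ∀ i j, i ≠ j → 0 ≤ p.syncCoef δ i j) : (p.PeJac δ).PosSemidef :=
  Matrix.PosSemidef.of_dotProduct_mulVec_nonneg
    (Matrix.isHermitian_iff_isSymm.2 (p.PeJac_isSymm hG hB δ))
    fun u => by simpa only [star_trivial] using p.PeJac_quadForm_nonneg hG hB δ hw u

/-- In the lossless case the synchronising coefficient IS `C_ij cos(δ_i − δ_j)`; so «acute line angles and
`B_ij ≥ 0`» give the sign hypothesis. [folklore] -/
theorem syncCoef_eq_of_lossless (hG : p.IsLossless) (δ : Fin n → ℝ) {i j : Fin n} (hij : i ≠ j) :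
    p.syncCoef δ i j = p.Ccoef i j * cos (δ i - δ j) := by
  simp [syncCoef, Dcoef, hG i j hij]

/-! ## §3 Positive damping, any profile: non-synchronous modes are damped -/

/-- **Every non-synchronous mode is damped (any positive damping profile, any `n`).** `M_i, D_i > 0`,
lossless reciprocal network, `L(δ) ⪰ 0` (e.g. `PeJac_posSemidef_of_acute`): every complex eigenpair
`(z, [x; y])` of `J(δ)` has `L(δ) x = 0` (synchronous type) or `Re z < 0`. No certificate, no tool; what is
NOT given here is a rate. CERTIFIED: matrix statement; MODELLED: MV-2L (+ MV-6N for the droop reading)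
[cite: SauerPai1998, §6.10]; cf. [cite: DorflerBullo2012, §II]. No stability sentence. -/
theorem eig_re_neg_of_posSemidef (hM : ∀ i, 0 < p.M i) (hD : ∀ i, 0 < p.D i) (δ : Fin n → ℝ)
    (hL : (p.PeJac δ).PosSemidef) {z : ℂ} {w : Fin n ⊕ Fin n → ℂ} (hw : w ≠ 0)
    (hJ : (p.jacMatrix δ).map ((↑) : ℝ → ℂ) *ᵥ w = z • w) :
    (p.PeJac δ).map ((↑) : ℝ → ℂ) *ᵥ (w ∘ Sum.inl) = 0 ∨ z.re < 0 := by
  have hM' : ∀ i, p.M i ≠ 0 := fun i => (hM i).ne'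
  set x := w ∘ Sum.inl with hxdef
  have hx : x ≠ 0 := p.jacMatrix_eig_fst_ne_zero hM' δ hJ hw
  have hray := p.eig_rayleigh hM' δ hJ
  -- the three real coefficients
  set a : ℝ := ∑ i, p.M i * Complex.normSq (x i) with hadef
  set b : ℝ := ∑ i, p.D i * Complex.normSq (x i) with hbdef
  obtain ⟨i0, hi0⟩ : ∃ i, x i ≠ 0 := by
    by_contra h
    push Not at h
    exact hx (funext h)
  have ha : 0 < a := lt_of_lt_of_le (mul_pos (hM i0) (Complex.normSq_pos.2 hi0))
    (Finset.single_le_sum (f := fun i => p.M i * Complex.normSq (x i))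
      (fun j _ => mul_nonneg (hM j).le (Complex.normSq_nonneg _)) (Finset.mem_univ i0))
  have hb : 0 < b := lt_of_lt_of_le (mul_pos (hD i0) (Complex.normSq_pos.2 hi0))
    (Finset.single_le_sum (f := fun i => p.D i * Complex.normSq (x i))
      (fun j _ => mul_nonneg (hD j).le (Complex.normSq_nonneg _)) (Finset.mem_univ i0))
  -- `c = x* L x` is real and nonnegative (PSD transfer to ℂ)
  have hLC : ((p.PeJac δ).map Complex.ofRealHom).PosSemidef := by
    open scoped MatrixOrder in
    obtain ⟨B, hB⟩ := CStarAlgebra.nonneg_iff_eq_star_mul_self.mp hL.nonneg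
    rw [hB, Matrix.star_eq_conjTranspose, Matrix.map_mul,
      Matrix.conjTranspose_map _ (fun a => by simp)]
    exact Matrix.posSemidef_conjTranspose_mul_self _
  set c : ℂ := star x ⬝ᵥ ((p.PeJac δ).map ((↑) : ℝ → ℂ) *ᵥ x) with hcdef
  have hc0 : 0 ≤ c := hLC.dotProduct_mulVec_nonneg x
  obtain ⟨hcre, hcim⟩ := Complex.nonneg_iff.1 hc0
  by_cases hc : c = 0
  · left
    exact (hLC.dotProduct_mulVec_zero_iff x).1 hc
  · right
    have hcre' : c.re ≠ 0 := by
      intro h0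
      exact hc (Complex.ext h0 (by simpa using hcim.symm))
    have hcpos : 0 < c.re := lt_of_le_of_ne hcre (Ne.symm hcre')
    have hcC : (c.re : ℂ) = c := Complex.ext (by simp) (by simpa using hcim)
    have haC : (a : ℂ) ≠ 0 := by exact_mod_cast ha.ne'
    have hz : z ^ 2 + ((b / a : ℝ) : ℂ) * z + ((c.re / a : ℝ) : ℂ) = 0 := by
      have h := hray
      rw [← hcC] at h
      push_cast
      field_simp
      linear_combination h
    exact Literature.Analysis.ODE.RouthHurwitz.quadratic_re_neg (div_pos hb ha) (div_pos hcpos ha) z hz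

/-- **Synchronous-type modes are real and non-positive**: if the angle part of an eigenpair is annihilated
by `L(δ)` then `z = 0` (the rotational symmetry) or `z = −(Σ D_i|x_i|²)/(Σ M_i|x_i|²) < 0` (for uniform
damping: `−d`; in general a Rayleigh quotient of the damping-to-inertia ratios, e.g. the centre-of-inertia
frequency mode `x = 1`: `z = −ΣD_i/ΣM_i`). [folklore] -/
theorem eig_sync_general (hM : ∀ i, 0 < p.M i) (δ : Fin n → ℝ) {z : ℂ} {w : Fin n ⊕ Fin n → ℂ}
    (hw : w ≠ 0) (hJ : (p.jacMatrix δ).map ((↑) : ℝ → ℂ) *ᵥ w = z • w)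
    (hL : (p.PeJac δ).map ((↑) : ℝ → ℂ) *ᵥ (w ∘ Sum.inl) = 0) :
    z = 0 ∨ z = -(((∑ i, p.D i * Complex.normSq ((w ∘ Sum.inl) i)) /
      (∑ i, p.M i * Complex.normSq ((w ∘ Sum.inl) i)) : ℝ) : ℂ) := by
  have hM' : ∀ i, p.M i ≠ 0 := fun i => (hM i).ne'
  have hx : w ∘ Sum.inl ≠ 0 := p.jacMatrix_eig_fst_ne_zero hM' δ hJ hw
  have hray := p.eig_rayleigh hM' δ hJ
  rw [hL, dotProduct_zero, zero_add] at hray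
  obtain ⟨i0, hi0⟩ : ∃ i, (w ∘ Sum.inl) i ≠ 0 := by
    by_contra h
    push Not at h
    exact hx (funext h)
  have ha : 0 < ∑ i, p.M i * Complex.normSq ((w ∘ Sum.inl) i) :=
    lt_of_lt_of_le (mul_pos (hM i0) (Complex.normSq_pos.2 hi0))
      (Finset.single_le_sum (f := fun i => p.M i * Complex.normSq ((w ∘ Sum.inl) i))
        (fun j _ => mul_nonneg (hM j).le (Complex.normSq_nonneg _)) (Finset.mem_univ i0))
  have haC : ((∑ i, p.M i * Complex.normSq ((w ∘ Sum.inl) i) : ℝ) : ℂ) ≠ 0 := by exact_mod_cast ha.ne'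
  have hfac : z * (((∑ i, p.D i * Complex.normSq ((w ∘ Sum.inl) i) : ℝ) : ℂ)
      + z * ((∑ i, p.M i * Complex.normSq ((w ∘ Sum.inl) i) : ℝ) : ℂ)) = 0 := by
    linear_combination hray
  rcases mul_eq_zero.1 hfac with h | h
  · exact Or.inl h
  · right
    rw [Complex.ofReal_div]
    field_simp
    linear_combination h

/-- **Acute equilibrium + positive damping ⇒ every non-synchronous mode is damped** (the sign-check form:
`C_ij cos(δ_i − δ_j) ≥ 0` for `i ≠ j`, `M_i, D_i > 0`, lossless reciprocal network). CERTIFIED: matrix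
statement about `J(δ)`; MODELLED: MV-2L [cite: SauerPai1998, §6.10]; cf. [cite: DorflerBullo2012, §II].
No stability sentence. -/
theorem eig_re_neg_of_acute (hM : ∀ i, 0 < p.M i) (hD : ∀ i, 0 < p.D i) (hG : p.IsLossless)
    (hB : ∀ i j, p.B i j = p.B j i) (δ : Fin n → ℝ)
    (hw0 : ∀ i j, i ≠ j → 0 ≤ p.Ccoef i j * cos (δ i - δ j)) {z : ℂ} {w : Fin n ⊕ Fin n → ℂ} (hw : w ≠ 0)
    (hJ : (p.jacMatrix δ).map ((↑) : ℝ → ℂ) *ᵥ w = z • w) :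
    (p.PeJac δ).map ((↑) : ℝ → ℂ) *ᵥ (w ∘ Sum.inl) = 0 ∨ z.re < 0 :=
  p.eig_re_neg_of_posSemidef hM hD δ
    (p.PeJac_posSemidef_of_acute hG hB δ fun i j hij => by
      rw [p.syncCoef_eq_of_lossless hG δ hij]; exact hw0 i j hij) hw hJ

end ClassicalSwing

/-! ## §4 Reading on droop microgrids with HETEROGENEOUS filter constants -/

namespace DroopMicrogrid

variable {n : ℕ} (mg : DroopMicrogrid n)

/-- **Any lossless droop microgrid, any positive filter constants `τ_Pi` and gains `λ^p_i` (frozen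
voltages `V`), acute equilibrium line angles (`V_iV_jB_ij cos(δ_i − δ_j) ≥ 0`): every non-synchronous mode of
the linearisation has `Re z < 0`** — sign checks only; a certified RATE is what the common-filter lane
(`eig_re_lt_neg_of_commonFilter`) or certnum's box tool adds. CERTIFIED: matrix statement; MODELLED: MV-6N +
lossless reciprocal network [cite: KunduEtAl2019, eqs. (4a)–(4b), (5a)] [cite: SchifferEtAl2014, Remark 3.3].
No sentence here says a microgrid is stable. -/
theorem eig_re_neg_of_acute (hk : ∀ i, 0 < mg.kP i) (hτ : ∀ i, 0 < mg.τP i)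
    (hG : ∀ i j, i ≠ j → mg.G i j = 0) (hB : ∀ i j, mg.B i j = mg.B j i) (V δ : Fin n → ℝ)
    (hw0 : ∀ i j, i ≠ j → 0 ≤ V i * V j * mg.B i j * cos (δ i - δ j))
    {z : ℂ} {w : Fin n ⊕ Fin n → ℂ} (hw : w ≠ 0)
    (hJ : ((mg.toClassicalSwing V).jacMatrix δ).map ((↑) : ℝ → ℂ) *ᵥ w = z • w) :
    ((mg.toClassicalSwing V).PeJac δ).map ((↑) : ℝ → ℂ) *ᵥ (w ∘ Sum.inl) = 0 ∨ z.re < 0 := by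
  have hM : ∀ i, 0 < (mg.toClassicalSwing V).M i := fun i => by
    simp only [toClassicalSwing]; exact div_pos (hτ i) (hk i)
  have hD : ∀ i, 0 < (mg.toClassicalSwing V).D i := fun i => by
    simp only [toClassicalSwing]; exact div_pos one_pos (hk i)
  exact (mg.toClassicalSwing V).eig_re_neg_of_acute hM hD hG hB δ
    (fun i j hij => by simpa [ClassicalSwing.Ccoef, toClassicalSwing] using hw0 i j hij) hw hJ

end DroopMicrogrid

/-! ## §5 Oscillatory modes: the decay rate is a weighted mean of the damping ratios `D_i/(2M_i)` -/

namespace ClassicalSwing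

variable {n : ℕ} (p : ClassicalSwing n)

/-- **Every OSCILLATORY mode decays at a weighted-mean damping ratio.** `M_i > 0`, lossless reciprocal
network, `L(δ) ⪰ 0`: an eigenpair `(z, [x; y])` of `J(δ)` with `Im z ≠ 0` has
`Re z = −(Σ D_i|x_i|²)/(2 Σ M_i|x_i|²)` EXACTLY, hence `−d_max/2 ≤ Re z ≤ −d_min/2` whenever
`d_min ≤ D_i/M_i ≤ d_max` for all `i` (droop reading: every oscillatory mode of a lossless microgrid decays at a
rate between `min_i 1/(2τ_Pi)` and `max_i 1/(2τ_Pi)` — no tool; only the real, aperiodic modes need a rate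
certificate). CERTIFIED: matrix statement; MODELLED: MV-2L / MV-6N. [folklore] -/
theorem eig_re_of_im_ne_zero (hM : ∀ i, 0 < p.M i) (δ : Fin n → ℝ)
    (hL : (p.PeJac δ).PosSemidef) {dmin dmax : ℝ} (hmin : ∀ i, dmin * p.M i ≤ p.D i)
    (hmax : ∀ i, p.D i ≤ dmax * p.M i) {z : ℂ} {w : Fin n ⊕ Fin n → ℂ} (hw : w ≠ 0)
    (hJ : (p.jacMatrix δ).map ((↑) : ℝ → ℂ) *ᵥ w = z • w) (hz : z.im ≠ 0) :
    z.re = -((∑ i, p.D i * Complex.normSq ((w ∘ Sum.inl) i)) /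
        (2 * ∑ i, p.M i * Complex.normSq ((w ∘ Sum.inl) i))) ∧
      -(dmax / 2) ≤ z.re ∧ z.re ≤ -(dmin / 2) := by
  have hM' : ∀ i, p.M i ≠ 0 := fun i => (hM i).ne'
  have hx : w ∘ Sum.inl ≠ 0 := p.jacMatrix_eig_fst_ne_zero hM' δ hJ hw
  have hray := p.eig_rayleigh hM' δ hJ
  set a : ℝ := ∑ i, p.M i * Complex.normSq ((w ∘ Sum.inl) i) with hadef
  set b : ℝ := ∑ i, p.D i * Complex.normSq ((w ∘ Sum.inl) i) with hbdef
  obtain ⟨i0, hi0⟩ : ∃ i, (w ∘ Sum.inl) i ≠ 0 := by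
    by_contra h; push Not at h; exact hx (funext h)
  have ha : 0 < a := lt_of_lt_of_le (mul_pos (hM i0) (Complex.normSq_pos.2 hi0))
    (Finset.single_le_sum (f := fun i => p.M i * Complex.normSq ((w ∘ Sum.inl) i))
      (fun j _ => mul_nonneg (hM j).le (Complex.normSq_nonneg _)) (Finset.mem_univ i0))
  -- the constant term is real (PSD transfer), so the imaginary part of the Rayleigh identity reads
  -- `im z · (b + 2 a re z) = 0`
  have hLC : ((p.PeJac δ).map Complex.ofRealHom).PosSemidef := by
    open scoped MatrixOrder in
    obtain ⟨B, hB⟩ := CStarAlgebra.nonneg_iff_eq_star_mul_self.mp hL.nonneg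
    rw [hB, Matrix.star_eq_conjTranspose, Matrix.map_mul,
      Matrix.conjTranspose_map _ (fun a => by simp)]
    exact Matrix.posSemidef_conjTranspose_mul_self _
  have hcim : (star (w ∘ Sum.inl) ⬝ᵥ ((p.PeJac δ).map ((↑) : ℝ → ℂ) *ᵥ (w ∘ Sum.inl))).im = 0 :=
    (Complex.nonneg_iff.1 (hLC.dotProduct_mulVec_nonneg (w ∘ Sum.inl))).2.symm
  have him := congr_arg Complex.im hray
  simp only [Complex.add_im, hcim, Complex.mul_im, Complex.ofReal_re, Complex.ofReal_im, mul_zero,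
    zero_add, Complex.zero_im, sq, Complex.mul_re] at him
  -- him : z.im * b + (z.re * z.im + z.im * z.re) * a = 0
  have hkey : z.re = -(b / (2 * a)) := by
    have h2 : z.im * (b + 2 * a * z.re) = 0 := by linear_combination him
    rcases mul_eq_zero.1 h2 with h | h
    · exact absurd h hz
    · field_simp; linarith
  refine ⟨hkey, ?_, ?_⟩
  · -- b ≤ dmax·a
    have hb : b ≤ dmax * a := by
      simp only [hadef, hbdef, Finset.mul_sum]
      exact Finset.sum_le_sum fun i _ => by
        have := mul_le_mul_of_nonneg_right (hmax i) (Complex.normSq_nonneg ((w ∘ Sum.inl) i))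
        linarith [this]
    rw [hkey, neg_le_neg_iff, div_le_div_iff₀ (by positivity) (by positivity)]
    nlinarith
  · have hb : dmin * a ≤ b := by
      simp only [hadef, hbdef, Finset.mul_sum]
      exact Finset.sum_le_sum fun i _ => by
        have := mul_le_mul_of_nonneg_right (hmin i) (Complex.normSq_nonneg ((w ∘ Sum.inl) i))
        linarith [this]
    rw [hkey, neg_le_neg_iff, div_le_div_iff₀ (by positivity) (by positivity)]
    nlinarith

end ClassicalSwing

end Summit.Ventures.GridStability.Models

end
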